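import Summits.Ventures.PercRepro.SixThreeTable

/-!
# PercRepro — the (6,3) table for every `g ≥ 41` (Step 5 of Lemma PL; p3, gen 7)

mine-2's `MINE2-RLS.md` §19.7′ (Step 5 of Lemma PL in the table vocabulary of §19.9; referee-read by ref-2): the
additive profile function `Δ_t(g, P) = A_t(g) + Σ_ℓ B_t(g, m_ℓ)` of `SixThreeTable.lean` is nonnegative in each of the
five row shapes (general plane without / with one long line, line + point, two lines meeting, two disjoint lines) for
EVERY `g ≥ 41`, `t ∈ {1, 2, 3}` and every admitted profile (every line `≤ g − 1`, `Σ C(m,2) ≤ C(g,2)`, at most one line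
longer than `h = ⌊(g+1)/2⌋`, general planes with every line `≤ g − 3`).  Together with the kernel table
(`4 ≤ g ≤ 40`) this gives the five rows for every `g ≥ 4`: `table_general_short_all`, `table_general_long_all`,
`table_linePoint_all`, `table_twoLines_meet_all`, `table_twoLines_disj_all` — the same statements as the five
`table_*` theorems of `SixThreeTable.lean` with the hypothesis `g ≤ 40` dropped.

The proof follows §19.7′ with rational constants:
* Lemma 5.1 — the type values are monotone from their values at `s = 5` (lp, `(s−2)`) and `s = 6` (rest):
  `vLp5 t = v_t(9/19, 36/121, 36/281)`, `vNon5 t = v_t(9/13, 36/73, 36/137)`, `r6 t = v_t(36/41, 36/47, 36/67)`, from the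
  exponential inequalities `9s ≤ 6^{s−3} + 9`, `36 s ≤ 5·6^{s−3}`, `36 s ≤ 6^{s−3}`, `C(s,2) ≤ 5 C(s−3,2)`;
  every value lies in `[0, 15]`.
* Lemma 5.2 — `A_t(g) ≥ r₆·(2^g − S₅(g)) − 3·2^g` (`A_ge`).
* Lemma 5.3 — one line of size `m = g − j`: `Δ_t(g, [m]) ≥ 2^m·cNum_t(j) − loss_t(g, m)` (`Δ_single_ge`, from the
  Vandermonde lower bounds on the counts and the monotone values), `cNum_t(j) ≥ 2^j/2` for `j ≥ 2` (`cNum_ge`: a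
  `decide +kernel` check for `2 ≤ j ≤ 12`, the `r₆`-tail beyond), `cNum_t(1) ≥ 1/2` (line + point), and the polynomial
  loss `≤ 2^g/100` (`loss_le`, via `3200·g^5 ≤ 2^g`).
* Lemma 5.4 — short lines: `B_t(g, m) ≥ −15·(3 + 2g + C(g,2))·2^m` (`B_ge`), and over the short lines of an admitted
  profile `Σ B ≥ −(6/100)·2^g` (`sum_B_short_ge`, from `2^m/C(m,2)` increasing and `6150·(2k² + 5k + 5) ≤ 6·2^k`).
* The five rows (`*_large`) are then `1/2 − 1/100 − 6/100 > 0` in units of `2^g`, the line + point row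
  `1/4 − 1/100 > 0`, with the constants `3`, `6`, `12` absorbed by `2^g ≥ 2^41`.

Everything is stated over the definitions of `SixThreeTable.lean` (`A`, `B`, `Δ`, `F`, `D`, the counts and values);
no matroid enters.  Imports `SixThreeTable` only.
-/

namespace PercRepro.SixThree.Table

/-! ## Step 5 (g ≥ 41), part I: the type values — explicit forms, bounds, monotone lower bounds -/

/-- `v_1(a, b, c) = 5a + 7b + 3c`. -/
theorem v_one (a b c : ℚ) : v 1 a b c = 5 * a + 7 * b + 3 * c := by
  simp only [v, πt, ch_eq_choose]
  norm_num [Nat.choose]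

/-- `v_2(a, b, c) = 4a + 5b + c`. -/
theorem v_two (a b c : ℚ) : v 2 a b c = 4 * a + 5 * b + c := by
  simp only [v, πt, ch_eq_choose]
  norm_num [Nat.choose]

/-- `v_3(a, b, c) = 3a + 3b`. -/
theorem v_three (a b c : ℚ) : v 3 a b c = 3 * a + 3 * b := by
  simp only [v, πt, ch_eq_choose]
  norm_num [Nat.choose]

/-- `v_t` is monotone in each share (`t ∈ {1,2,3}`). -/
theorem v_mono {t : ℕ} (ht : t = 1 ∨ t = 2 ∨ t = 3) {a b c a' b' c' : ℚ} (ha : a ≤ a') (hb : b ≤ b')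
    (hc : c ≤ c') : v t a b c ≤ v t a' b' c' := by
  rcases ht with rfl | rfl | rfl
  · rw [v_one, v_one]; linarith
  · rw [v_two, v_two]; linarith
  · rw [v_three, v_three]; linarith

/-- `v_t ≥ 0` on nonnegative shares. -/
theorem v_nonneg {t : ℕ} (ht : t = 1 ∨ t = 2 ∨ t = 3) {a b c : ℚ} (ha : 0 ≤ a) (hb : 0 ≤ b) (hc : 0 ≤ c) :
    0 ≤ v t a b c := by
  rcases ht with rfl | rfl | rfl
  · rw [v_one]; linarith
  · rw [v_two]; linarith
  · rw [v_three]; linarith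

/-- `v_t ≤ 15` on shares `≤ 1`. -/
theorem v_le_fifteen {t : ℕ} (ht : t = 1 ∨ t = 2 ∨ t = 3) {a b c : ℚ} (ha : a ≤ 1) (hb : b ≤ 1) (hc : c ≤ 1) :
    v t a b c ≤ 15 := by
  rcases ht with rfl | rfl | rfl
  · rw [v_one]; linarith
  · rw [v_two]; linarith
  · rw [v_three]; linarith

/-- `0 ≤ w₁` for `Λ ≥ 0`. -/
theorem w1_nonneg (b : ℕ) {Λ : ℚ} (hΛ : 0 ≤ Λ) : 0 ≤ w1 b Λ := by
  unfold w1; positivity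

/-- `0 ≤ w₂` for `Λ ≥ 0`. -/
theorem w2_nonneg (b : ℕ) {Λ : ℚ} (hΛ : 0 ≤ Λ) : 0 ≤ w2 b Λ := by
  unfold w2; positivity

/-- `0 ≤ w₂⁻` for `Λ ≥ 0`. -/
theorem w2m_nonneg (b : ℕ) {Λ : ℚ} (hΛ : 0 ≤ Λ) : 0 ≤ w2m b Λ := by
  unfold w2m; positivity

/-- `w₁ ≤ 1` for `Λ ≥ 0`. -/
theorem w1_le_one (b : ℕ) {Λ : ℚ} (hΛ : 0 ≤ Λ) : w1 b Λ ≤ 1 := by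
  unfold w1
  rw [div_le_one (by positivity)]
  linarith

/-- `w₂ ≤ 1` for `Λ ≥ 0`. -/
theorem w2_le_one (b : ℕ) {Λ : ℚ} (hΛ : 0 ≤ Λ) : w2 b Λ ≤ 1 := by
  unfold w2
  rw [div_le_one (by positivity)]
  have : (0 : ℚ) ≤ b := by positivity
  linarith

/-- `w₂⁻ ≤ 1` for `Λ ≥ 0`. -/
theorem w2m_le_one (b : ℕ) {Λ : ℚ} (hΛ : 0 ≤ Λ) : w2m b Λ ≤ 1 := by
  unfold w2m
  rw [div_le_one (by positivity)]
  have : (0 : ℚ) ≤ b := by positivity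
  linarith

/-- A lower bound on `w₁` from an upper bound `Λ ≤ μ·6^{b−3}`: `w₁ ≥ 1/(1 + μ)`. -/
theorem w1_ge {b : ℕ} {Λ μ : ℚ} (hμ : 0 ≤ μ) (h : Λ ≤ μ * (6 : ℚ) ^ (b - 3)) (hΛ : 0 ≤ Λ) :
    1 / (1 + μ) ≤ w1 b Λ := by
  unfold w1
  have hp : (0 : ℚ) < (6 : ℚ) ^ (b - 3) := by positivity
  rw [div_le_div_iff₀ (by positivity) (by positivity)]
  nlinarith

/-- A lower bound on `w₂` from `2Λ + b ≤ μ·6^{b−3}`: `w₂ ≥ 1/(1 + μ)`. -/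
theorem w2_ge {b : ℕ} {Λ μ : ℚ} (hμ : 0 ≤ μ) (h : 2 * Λ + b ≤ μ * (6 : ℚ) ^ (b - 3)) (hΛ : 0 ≤ Λ) :
    1 / (1 + μ) ≤ w2 b Λ := by
  unfold w2
  have hp : (0 : ℚ) < (6 : ℚ) ^ (b - 3) := by positivity
  have hb : (0 : ℚ) ≤ b := by positivity
  rw [div_le_div_iff₀ (by positivity) (by positivity)]
  nlinarith

/-- A lower bound on `w₂⁻` from `6Λ + b ≤ μ·6^{b−3}`: `w₂⁻ ≥ 1/(1 + μ)`. -/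
theorem w2m_ge {b : ℕ} {Λ μ : ℚ} (hμ : 0 ≤ μ) (h : 6 * Λ + b ≤ μ * (6 : ℚ) ^ (b - 3)) (hΛ : 0 ≤ Λ) :
    1 / (1 + μ) ≤ w2m b Λ := by
  unfold w2m
  have hp : (0 : ℚ) < (6 : ℚ) ^ (b - 3) := by positivity
  have hb : (0 : ℚ) ≤ b := by positivity
  rw [div_le_div_iff₀ (by positivity) (by positivity)]
  nlinarith

/-! ### The exponential inequalities behind the monotone bounds (all by `Nat.le_induction`) -/

/-- `9 s ≤ 6^{s−3} + 9` for `s ≥ 5`. -/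
theorem nine_mul_le_six_pow {s : ℕ} (hs : 5 ≤ s) : 9 * s ≤ 6 ^ (s - 3) + 9 := by
  induction s, hs using Nat.le_induction with
  | base => norm_num
  | succ n hn ih =>
    have e : n + 1 - 3 = (n - 3) + 1 := by omega
    rw [e, pow_succ]
    omega

/-- `108 s ≤ 13·6^{s−3} + 72` for `s ≥ 5`. -/
theorem lp_w2_aux {s : ℕ} (hs : 5 ≤ s) : 108 * s ≤ 13 * 6 ^ (s - 3) + 72 := by
  induction s, hs using Nat.le_induction with
  | base => norm_num
  | succ n hn ih =>
    have e : n + 1 - 3 = (n - 3) + 1 := by omega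
    rw [e, pow_succ]
    omega

/-- `252 s ≤ 29·6^{s−3} + 216` for `s ≥ 5`. -/
theorem lp_w2m_aux {s : ℕ} (hs : 5 ≤ s) : 252 * s ≤ 29 * 6 ^ (s - 3) + 216 := by
  induction s, hs using Nat.le_induction with
  | base => norm_num
  | succ n hn ih =>
    have e : n + 1 - 3 = (n - 3) + 1 := by omega
    rw [e, pow_succ]
    omega

/-- `36 s ≤ 5·6^{s−3}` for `s ≥ 5`. -/
theorem non_aux {s : ℕ} (hs : 5 ≤ s) : 36 * s ≤ 5 * 6 ^ (s - 3) := by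
  induction s, hs using Nat.le_induction with
  | base => norm_num
  | succ n hn ih =>
    have e : n + 1 - 3 = (n - 3) + 1 := by omega
    rw [e, pow_succ]
    omega

/-- `36 s ≤ 6^{s−3}` for `s ≥ 6`. -/
theorem rest_aux {s : ℕ} (hs : 6 ≤ s) : 36 * s ≤ 6 ^ (s - 3) := by
  induction s, hs using Nat.le_induction with
  | base => norm_num
  | succ n hn ih =>
    have e : n + 1 - 3 = (n - 3) + 1 := by omega
    rw [e, pow_succ]
    omega

/-- `C(s,2) ≤ 5·C(s−3,2)` for `s ≥ 6` (in `ℚ`). -/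
theorem choose_two_le_five_mul {s : ℕ} (hs : 6 ≤ s) : (s.choose 2 : ℚ) ≤ 5 * ((s - 3).choose 2 : ℚ) := by
  rw [Nat.cast_choose_two, Nat.cast_choose_two]
  have h3 : ((s - 3 : ℕ) : ℚ) = (s : ℚ) - 3 := by rw [Nat.cast_sub (by omega)]; push_cast; ring
  rw [h3]
  have hs' : (6 : ℚ) ≤ s := by exact_mod_cast hs
  nlinarith


/-! ### The three `Λ`-families are nonnegative; `6^{s−4}`, `6^{s−5}` against `6^{s−3}` -/

/-- `Λ^{lp}_s ≥ 0`. -/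
theorem ΛLp_nonneg (s : ℕ) : 0 ≤ ΛLp s := by unfold ΛLp; positivity
/-- `Λ^{s−2}_s ≥ 0`. -/
theorem ΛNon_nonneg (s : ℕ) : 0 ≤ ΛNon s := by unfold ΛNon; positivity
/-- `Λ^{rest}_s ≥ 0`. -/
theorem ΛRest_nonneg (s : ℕ) : 0 ≤ ΛRest s := by unfold ΛRest; positivity

/-- `6 · 6^{s−4} = 6^{s−3}` for `s ≥ 4`. -/
theorem six_pow_sub_four {s : ℕ} (hs : 4 ≤ s) : (6 : ℚ) ^ (s - 3) = 6 * (6 : ℚ) ^ (s - 4) := by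
  have e : s - 3 = (s - 4) + 1 := by omega
  rw [e, pow_succ]; ring

/-- `36 · 6^{s−5} = 6^{s−3}` for `s ≥ 5`. -/
theorem six_pow_sub_five {s : ℕ} (hs : 5 ≤ s) : (6 : ℚ) ^ (s - 3) = 36 * (6 : ℚ) ^ (s - 5) := by
  have e : s - 3 = (s - 5) + 2 := by omega
  rw [e, pow_add]; ring

/-! ### The lower bounds at `s = 5` (lp, `(s−2)`-type) and `s = 6` (rest) -/

/-- `w₁(s, Λ^{lp}_s) ≥ 9/19` for `s ≥ 5`. -/
theorem w1_lp_ge {s : ℕ} (hs : 5 ≤ s) : 9 / 19 ≤ w1 s (ΛLp s) := by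
  have h : (9 : ℚ) * s ≤ (6 : ℚ) ^ (s - 3) + 9 := by exact_mod_cast nine_mul_le_six_pow hs
  have hs1 : ((s - 1 : ℕ) : ℚ) = (s : ℚ) - 1 := by rw [Nat.cast_sub (by omega)]; push_cast; ring
  have := w1_ge (b := s) (Λ := ΛLp s) (μ := 10 / 9) (by norm_num) (by unfold ΛLp; rw [hs1]; linarith)
    (ΛLp_nonneg s)
  norm_num at this
  exact this

/-- `w₂(s, Λ^{lp}_s) ≥ 36/121` for `s ≥ 5`. -/
theorem w2_lp_ge {s : ℕ} (hs : 5 ≤ s) : 36 / 121 ≤ w2 s (ΛLp s) := by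
  have h : (108 : ℚ) * s ≤ 13 * (6 : ℚ) ^ (s - 3) + 72 := by exact_mod_cast lp_w2_aux hs
  have hs1 : ((s - 1 : ℕ) : ℚ) = (s : ℚ) - 1 := by rw [Nat.cast_sub (by omega)]; push_cast; ring
  have := w2_ge (b := s) (Λ := ΛLp s) (μ := 85 / 36) (by norm_num) (by unfold ΛLp; rw [hs1]; linarith)
    (ΛLp_nonneg s)
  norm_num at this
  exact this

/-- `w₂⁻(s, Λ^{lp}_s) ≥ 36/281` for `s ≥ 5`. -/
theorem w2m_lp_ge {s : ℕ} (hs : 5 ≤ s) : 36 / 281 ≤ w2m s (ΛLp s) := by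
  have h : (252 : ℚ) * s ≤ 29 * (6 : ℚ) ^ (s - 3) + 216 := by exact_mod_cast lp_w2m_aux hs
  have hs1 : ((s - 1 : ℕ) : ℚ) = (s : ℚ) - 1 := by rw [Nat.cast_sub (by omega)]; push_cast; ring
  have := w2m_ge (b := s) (Λ := ΛLp s) (μ := 245 / 36) (by norm_num) (by unfold ΛLp; rw [hs1]; linarith)
    (ΛLp_nonneg s)
  norm_num at this
  exact this

/-- `w₁(s, Λ^{s−2}_s) ≥ 9/13` for `s ≥ 5`. -/
theorem w1_non_ge {s : ℕ} (hs : 5 ≤ s) : 9 / 13 ≤ w1 s (ΛNon s) := by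
  have h : (36 : ℚ) * s ≤ 5 * (6 : ℚ) ^ (s - 3) := by exact_mod_cast non_aux hs
  have h4 := six_pow_sub_four (by omega : 4 ≤ s)
  have := w1_ge (b := s) (Λ := ΛNon s) (μ := 4 / 9) (by norm_num) (by unfold ΛNon; linarith)
    (ΛNon_nonneg s)
  norm_num at this
  exact this

/-- `w₂(s, Λ^{s−2}_s) ≥ 36/73` for `s ≥ 5`. -/
theorem w2_non_ge {s : ℕ} (hs : 5 ≤ s) : 36 / 73 ≤ w2 s (ΛNon s) := by
  have h : (36 : ℚ) * s ≤ 5 * (6 : ℚ) ^ (s - 3) := by exact_mod_cast non_aux hs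
  have h4 := six_pow_sub_four (by omega : 4 ≤ s)
  have := w2_ge (b := s) (Λ := ΛNon s) (μ := 37 / 36) (by norm_num) (by unfold ΛNon; linarith)
    (ΛNon_nonneg s)
  norm_num at this
  exact this

/-- `w₂⁻(s, Λ^{s−2}_s) ≥ 36/137` for `s ≥ 5`. -/
theorem w2m_non_ge {s : ℕ} (hs : 5 ≤ s) : 36 / 137 ≤ w2m s (ΛNon s) := by
  have h : (36 : ℚ) * s ≤ 5 * (6 : ℚ) ^ (s - 3) := by exact_mod_cast non_aux hs
  have h4 := six_pow_sub_four (by omega : 4 ≤ s)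
  have := w2m_ge (b := s) (Λ := ΛNon s) (μ := 101 / 36) (by norm_num) (by unfold ΛNon; linarith)
    (ΛNon_nonneg s)
  norm_num at this
  exact this

/-- `Λ^{rest}_s ≤ (5/36)·6^{s−3}` for `s ≥ 6`. -/
theorem ΛRest_le {s : ℕ} (hs : 6 ≤ s) : ΛRest s ≤ 5 / 36 * (6 : ℚ) ^ (s - 3) := by
  unfold ΛRest
  rw [six_pow_sub_five (by omega), ch_eq_choose, ch_eq_choose]
  have hc := choose_two_le_five_mul hs
  have hpos : (0 : ℚ) < ((s - 3).choose 2 : ℕ) := by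
    have : 1 ≤ (s - 3).choose 2 := Nat.succ_le_of_lt (Nat.choose_pos (by omega))
    exact_mod_cast this
  rw [div_le_iff₀ hpos]
  have hp : (0 : ℚ) ≤ (6 : ℚ) ^ (s - 5) := by positivity
  nlinarith

/-- `w₁(s, Λ^{rest}_s) ≥ 36/41` for `s ≥ 6`. -/
theorem w1_rest_ge {s : ℕ} (hs : 6 ≤ s) : 36 / 41 ≤ w1 s (ΛRest s) := by
  have := w1_ge (b := s) (Λ := ΛRest s) (μ := 5 / 36) (by norm_num) (ΛRest_le hs) (ΛRest_nonneg s)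
  norm_num at this
  exact this

/-- `w₂(s, Λ^{rest}_s) ≥ 36/47` for `s ≥ 6`. -/
theorem w2_rest_ge {s : ℕ} (hs : 6 ≤ s) : 36 / 47 ≤ w2 s (ΛRest s) := by
  have h : (36 : ℚ) * s ≤ (6 : ℚ) ^ (s - 3) := by exact_mod_cast rest_aux hs
  have hΛ := ΛRest_le hs
  have := w2_ge (b := s) (Λ := ΛRest s) (μ := 11 / 36) (by norm_num) (by linarith) (ΛRest_nonneg s)
  norm_num at this
  exact this

/-- `w₂⁻(s, Λ^{rest}_s) ≥ 36/67` for `s ≥ 6`. -/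
theorem w2m_rest_ge {s : ℕ} (hs : 6 ≤ s) : 36 / 67 ≤ w2m s (ΛRest s) := by
  have h : (36 : ℚ) * s ≤ (6 : ℚ) ^ (s - 3) := by exact_mod_cast rest_aux hs
  have hΛ := ΛRest_le hs
  have := w2m_ge (b := s) (Λ := ΛRest s) (μ := 31 / 36) (by norm_num) (by linarith) (ΛRest_nonneg s)
  norm_num at this
  exact this

/-! ### The three constants of §19.7′ and the monotone bounds on the type values -/

/-- `v_t^{lp}(5) = v_t(9/19, 36/121, 36/281)` — the lower bound for every `v_t^{lp}(s)`, `s ≥ 5`. -/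
def vLp5 (t : ℕ) : ℚ := v t (9 / 19) (36 / 121) (36 / 281)
/-- `v_t^{s−2}(5) = v_t(9/13, 36/73, 36/137)` — the lower bound for every `v_t^{s−2}(s)`, `s ≥ 5`. -/
def vNon5 (t : ℕ) : ℚ := v t (9 / 13) (36 / 73) (36 / 137)
/-- `r₆(t) = v_t^{rest}(6) = v_t(36/41, 36/47, 36/67)` — the lower bound for every `v_t^{rest}(s)`, `s ≥ 6`. -/
def r6 (t : ℕ) : ℚ := v t (36 / 41) (36 / 47) (36 / 67)

/-- `v_t^{lp}(s) ≥ v_t^{lp}(5)` for `s ≥ 5`. -/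
theorem vLp_ge {t s : ℕ} (ht : t = 1 ∨ t = 2 ∨ t = 3) (hs : 5 ≤ s) : vLp5 t ≤ vLp t s :=
  v_mono ht (w1_lp_ge hs) (w2_lp_ge hs) (w2m_lp_ge hs)

/-- `v_t^{s−2}(s) ≥ v_t^{s−2}(5)` for `s ≥ 5`. -/
theorem vNon_ge {t s : ℕ} (ht : t = 1 ∨ t = 2 ∨ t = 3) (hs : 5 ≤ s) : vNon5 t ≤ vNon t s :=
  v_mono ht (w1_non_ge hs) (w2_non_ge hs) (w2m_non_ge hs)

/-- `v_t^{rest}(s) ≥ r₆(t)` for `s ≥ 6`. -/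
theorem vRest_ge {t s : ℕ} (ht : t = 1 ∨ t = 2 ∨ t = 3) (hs : 6 ≤ s) : r6 t ≤ vRest t s :=
  v_mono ht (w1_rest_ge hs) (w2_rest_ge hs) (w2m_rest_ge hs)

/-- Every type value is nonnegative. -/
theorem vLp_nonneg {t : ℕ} (ht : t = 1 ∨ t = 2 ∨ t = 3) (s : ℕ) : 0 ≤ vLp t s :=
  v_nonneg ht (w1_nonneg _ (ΛLp_nonneg s)) (w2_nonneg _ (ΛLp_nonneg s)) (w2m_nonneg _ (ΛLp_nonneg s))
/-- `v_t^{s−2}(s) ≥ 0`. -/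
theorem vNon_nonneg {t : ℕ} (ht : t = 1 ∨ t = 2 ∨ t = 3) (s : ℕ) : 0 ≤ vNon t s :=
  v_nonneg ht (w1_nonneg _ (ΛNon_nonneg s)) (w2_nonneg _ (ΛNon_nonneg s)) (w2m_nonneg _ (ΛNon_nonneg s))
/-- `v_t^{rest}(s) ≥ 0`. -/
theorem vRest_nonneg {t : ℕ} (ht : t = 1 ∨ t = 2 ∨ t = 3) (s : ℕ) : 0 ≤ vRest t s :=
  v_nonneg ht (w1_nonneg _ (ΛRest_nonneg s)) (w2_nonneg _ (ΛRest_nonneg s)) (w2m_nonneg _ (ΛRest_nonneg s))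
/-- `v_t^{tri} ≥ 0`. -/
theorem vTriple_nonneg {t : ℕ} (ht : t = 1 ∨ t = 2 ∨ t = 3) : 0 ≤ vTriple t :=
  v_nonneg ht (by norm_num) (by norm_num) (by norm_num)
/-- `v_t^{4gen} ≥ 0`. -/
theorem vGen4_nonneg {t : ℕ} (ht : t = 1 ∨ t = 2 ∨ t = 3) : 0 ≤ vGen4 t :=
  v_nonneg ht (w1_nonneg _ (by norm_num)) (w2_nonneg _ (by norm_num)) (w2m_nonneg _ (by norm_num))
/-- `v_t^{4col} ≥ 0`. -/
theorem vCol4_nonneg {t : ℕ} (ht : t = 1 ∨ t = 2 ∨ t = 3) : 0 ≤ vCol4 t :=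
  v_nonneg ht (w1_nonneg _ (by norm_num)) (w2_nonneg _ (by norm_num)) (w2m_nonneg _ (by norm_num))

/-- Every type value is at most `15`. -/
theorem vLp_le {t : ℕ} (ht : t = 1 ∨ t = 2 ∨ t = 3) (s : ℕ) : vLp t s ≤ 15 :=
  v_le_fifteen ht (w1_le_one _ (ΛLp_nonneg s)) (w2_le_one _ (ΛLp_nonneg s)) (w2m_le_one _ (ΛLp_nonneg s))
/-- `v_t^{s−2}(s) ≤ 15`. -/
theorem vNon_le {t : ℕ} (ht : t = 1 ∨ t = 2 ∨ t = 3) (s : ℕ) : vNon t s ≤ 15 :=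
  v_le_fifteen ht (w1_le_one _ (ΛNon_nonneg s)) (w2_le_one _ (ΛNon_nonneg s)) (w2m_le_one _ (ΛNon_nonneg s))
/-- `v_t^{rest}(s) ≤ 15`. -/
theorem vRest_le {t : ℕ} (ht : t = 1 ∨ t = 2 ∨ t = 3) (s : ℕ) : vRest t s ≤ 15 :=
  v_le_fifteen ht (w1_le_one _ (ΛRest_nonneg s)) (w2_le_one _ (ΛRest_nonneg s)) (w2m_le_one _ (ΛRest_nonneg s))
/-- `v_t^{tri} ≤ 15`. -/
theorem vTriple_le {t : ℕ} (ht : t = 1 ∨ t = 2 ∨ t = 3) : vTriple t ≤ 15 :=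
  v_le_fifteen ht (by norm_num) (by norm_num) (by norm_num)
/-- `v_t^{4gen} ≤ 15`. -/
theorem vGen4_le {t : ℕ} (ht : t = 1 ∨ t = 2 ∨ t = 3) : vGen4 t ≤ 15 :=
  v_le_fifteen ht (w1_le_one _ (by norm_num)) (w2_le_one _ (by norm_num)) (w2m_le_one _ (by norm_num))
/-- `v_t^{4col} ≤ 15`. -/
theorem vCol4_le {t : ℕ} (ht : t = 1 ∨ t = 2 ∨ t = 3) : vCol4 t ≤ 15 :=
  v_le_fifteen ht (w1_le_one _ (by norm_num)) (w2_le_one _ (by norm_num)) (w2m_le_one _ (by norm_num))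

/-- The constants are nonnegative and at most `15`; `r₆ ≥ 49/10`; `v^{lp}(5) ≥ 7/2 + 3·[t = 3] - 3 + …` (see below). -/
theorem vLp5_nonneg {t : ℕ} (ht : t = 1 ∨ t = 2 ∨ t = 3) : 0 ≤ vLp5 t :=
  v_nonneg ht (by norm_num) (by norm_num) (by norm_num)
/-- `v^{s−2}(5) ≥ 0`. -/
theorem vNon5_nonneg {t : ℕ} (ht : t = 1 ∨ t = 2 ∨ t = 3) : 0 ≤ vNon5 t :=
  v_nonneg ht (by norm_num) (by norm_num) (by norm_num)
/-- `r₆ ≥ 49/10` for `t ∈ {1,2,3}`. -/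
theorem r6_ge {t : ℕ} (ht : t = 1 ∨ t = 2 ∨ t = 3) : 49 / 10 ≤ r6 t := by
  rcases ht with rfl | rfl | rfl <;> simp only [r6, v_one, v_two, v_three] <;> norm_num
/-- `r₆ ≤ 15`. -/
theorem r6_le {t : ℕ} (ht : t = 1 ∨ t = 2 ∨ t = 3) : r6 t ≤ 15 :=
  v_le_fifteen ht (by norm_num) (by norm_num) (by norm_num)
/-- `v^{lp}(5) ≤ 15`. -/
theorem vLp5_le {t : ℕ} (ht : t = 1 ∨ t = 2 ∨ t = 3) : vLp5 t ≤ 15 :=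
  v_le_fifteen ht (by norm_num) (by norm_num) (by norm_num)
/-- `v^{s−2}(5) ≤ 15`. -/
theorem vNon5_le {t : ℕ} (ht : t = 1 ∨ t = 2 ∨ t = 3) : vNon5 t ≤ 15 :=
  v_le_fifteen ht (by norm_num) (by norm_num) (by norm_num)
/-- Line + point: `v^{lp}(5) − 3 + 3·[t = 3] ≥ 1/2`. -/
theorem vLp5_linePoint {t : ℕ} (ht : t = 1 ∨ t = 2 ∨ t = 3) :
    1 / 2 ≤ vLp5 t - 3 + (if t = 3 then 3 else 0) := by
  rcases ht with rfl | rfl | rfl <;> simp only [vLp5, v_one, v_two, v_three] <;> norm_num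


end PercRepro.SixThree.Table
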